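import Mathlib.Analysis.InnerProductSpace.Calculus
import Literature.Topology.FourManifolds.MMSWRasmussenFacts
import Literature.Topology.FourManifolds.SmoothEmbeddingCriteria
import Summits.SmoothPoincare4.SmoothPoincare4.Theses.DottedCircleRasmussen
import Summits.SmoothPoincare4.SmoothPoincare4.Theorems.DottedCircleRasmussenDcrGapHelperFriendsCarrierExterior

/-!
# Helper `helper_friendsCarrier_inversion` of stub `stub_friendsCarrier` (line `mk_friends`, crux `DcrGap`)
(item stmt-SmoothPoincare4-16128, route route-SmoothPoincare4-DottedCircleRasmussen)

**The chart at infinity of the model disc exterior.**  In the carrier `X` of the friends lemma the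
exterior piece is the model disc exterior `E = ℝ⁴ ∖ (D_k ∪ Δ₁)` with ONE point `q = ∞` added; the landed
`helper_friendsCarrier_exterior` makes both `E` and the inverted exterior
`E^ = {0} ∪ {y ≠ 0 | y/‖y‖² ∈ E}` open subsets of `ℝ⁴` (`TopologicalSpace.Opens`, hence open submanifolds).
This file supplies the map between them that the gluing step of the stub uses for its clauses
`IsSmoothEmbedding j`, `IsOpen (range j)`, `range j = (… ∪ {q})ᶜ` and
`∀ s ∈ 𝓝 q, ∃ R, ∀ a : E, R < ‖a‖ → j a ∈ s` (with `j = inr ∘ ι`, `q = inr 0`):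

* `helper_friendsCarrier_inversion` — `0 ∈ E^`, `0 ∉ E` (indeed `0 ∈ D_k`, `zero_mem_modelHandlebody`),
  and the inversion `ι : E → E^`, `ι a = a/‖a‖²`, is a smooth embedding (`Manifold.IsSmoothEmbedding`)
  with open range `E^ ∖ {0}` which tends to `0 ∈ E^` as `‖a‖ → ∞`.

Proof: the inversion in the unit sphere is a smooth involution of `ℝ⁴ ∖ {0}` (`‖y/‖y‖²‖ = 1/‖y‖`), so
`ι` is a globally defined partial diffeomorphism `E ⇀ E^` onto the open `E^ ∖ {0}`, hence a smooth
embedding (`isSmoothEmbedding_of_openPartialHomeomorph`, SmoothEmbeddingCriteria.lean); the limit clause is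
`‖ι a‖ = 1/‖a‖`.  Kosinski, *Differential Manifolds* (1993), VI §5; the inversion as in the tree's
`PalaisComplementBallInversion.lean`.  No definitions, no named facts, no `sorry`.
-/

-- the prescribed namespace `Summit.<P>.<Sub>.…` duplicates `SmoothPoincare4` (P = Sub)
set_option linter.dupNamespace false
set_option linter.style.longLine false

noncomputable section

open scoped Manifold ContDiff Topology
open Function Set Metric
open Literature.Topology.FourManifolds Literature.Topology.FourManifolds.MMSW

namespace Summit.SmoothPoincare4.SmoothPoincare4.Theorems.DcrGap.MkFriends

/-! ## The origin lies in the model handlebody -/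

/-- `Σ_{i<n} 1/(16 (i+1)²) ≤ (2 - 2/(n+1))/16` (telescoping against `2/((i+1)(i+2)) ≥ 1/(i+1)²`).
[folklore] -/
theorem sum_inv_sixteen_sq_le (n : ℕ) :
    ∑ i ∈ Finset.range n, 1 / (16 * (((i : ℕ) : ℝ) + 1) ^ 2) ≤ (2 - 2 / ((n : ℝ) + 1)) / 16 := by
  induction n with
  | zero => norm_num
  | succ n ih =>
    rw [Finset.sum_range_succ]
    have h1 : (0 : ℝ) < (n : ℝ) + 1 := by positivity
    have h2 : (0 : ℝ) < (n : ℝ) + 1 + 1 := by positivity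
    have key : 1 / (16 * (((n : ℕ) : ℝ) + 1) ^ 2) ≤ (2 / ((n : ℝ) + 1) - 2 / ((n : ℝ) + 1 + 1)) / 16 := by
      rw [div_sub_div _ _ h1.ne' h2.ne', div_div, div_le_div_iff₀ (by positivity) (by positivity)]
      nlinarith
    push_cast
    linarith

/-- **`0 ∈ D_k`**: at the origin the guard holds (`|0 - c_j|² = 16(j+1)² ≥ 16`) and
`G_k(0) = Σ_j 1/(16(j+1)²) < 1/8 ≤ 1`. [folklore] -/
theorem zero_mem_modelHandlebody (k : ℕ) : (0 : EuclideanSpace ℝ (Fin 4)) ∈ modelHandlebody k := by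
  have hhole : ∀ j : Fin k, holeTerm k j 0 = 16 * (((j : ℕ) : ℝ) + 1) ^ 2 := fun j => by
    simp only [holeTerm, PiLp.zero_apply]
    ring
  refine ⟨fun j => ?_, ?_⟩
  · rw [hhole]
    nlinarith [sq_nonneg (((j : ℕ) : ℝ)), (Nat.cast_nonneg (j : ℕ) : (0 : ℝ) ≤ _)]
  · have hG : levelFun k 0 = ∑ i ∈ Finset.range k, 1 / (16 * (((i : ℕ) : ℝ) + 1) ^ 2) := by
      unfold levelFun
      simp only [PiLp.zero_apply, hhole]
      rw [← Fin.sum_univ_eq_sum_range (fun i => 1 / (16 * (((i : ℕ) : ℝ) + 1) ^ 2)) k]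
      ring
    rw [hG]
    have hk : (0 : ℝ) < 2 / ((k : ℝ) + 1) := by positivity
    have := sum_inv_sixteen_sq_le k
    linarith

/-! ## The inversion in the unit sphere -/

/-- The inversion is an involution off the origin. [folklore] -/
theorem inv_normSq_smul_inv_normSq_smul {y : EuclideanSpace ℝ (Fin 4)} (hy : y ≠ 0) :
    (‖(‖y‖ ^ 2)⁻¹ • y‖ ^ 2)⁻¹ • ((‖y‖ ^ 2)⁻¹ • y) = y := by
  rw [norm_inv_normSq_smul, smul_smul, inv_pow, inv_inv]
  have hn : ‖y‖ ≠ 0 := norm_ne_zero_iff.2 hy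
  rw [show ‖y‖ ^ 2 * (‖y‖ ^ 2)⁻¹ = 1 from mul_inv_cancel₀ (pow_ne_zero 2 hn), one_smul]

/-- The inversion of a nonzero vector is nonzero. [folklore] -/
theorem inv_normSq_smul_ne_zero {y : EuclideanSpace ℝ (Fin 4)} (hy : y ≠ 0) : (‖y‖ ^ 2)⁻¹ • y ≠ 0 :=
  smul_ne_zero (inv_ne_zero (pow_ne_zero 2 (norm_ne_zero_iff.2 hy))) hy

/-- The inversion is `C^∞` off the origin. [folklore] -/
theorem contDiffAt_inv_normSq_smul {y : EuclideanSpace ℝ (Fin 4)} (hy : y ≠ 0) :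
    ContDiffAt ℝ ∞ (fun y : EuclideanSpace ℝ (Fin 4) => (‖y‖ ^ 2)⁻¹ • y) y :=
  ((contDiff_norm_sq ℝ).contDiffAt.inv (pow_ne_zero 2 (norm_ne_zero_iff.2 hy))).smul contDiffAt_id

/-! ## The chart at infinity -/

/-- **Helper `helper_friendsCarrier_inversion`** (registered on the crux item; the exterior bookkeeping of
stub `stub_friendsCarrier`).  For a model slice disc `Δ₁ = f₁(𝔻²)` let `E` be the model disc exterior
`{x | x ∉ D_k ∧ x ∉ Δ₁}` and `F = E^` the inverted exterior with the point at infinity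
`{0} ∪ {y ≠ 0 | y/‖y‖² ∉ D_k ∧ y/‖y‖² ∉ Δ₁}` (both open: `helper_friendsCarrier_exterior`), as
`TopologicalSpace.Opens ℝ⁴`.  Then `0 ∈ F`, `E` misses `0` (`0 ∈ D_k`), and the inversion `ι : E → F`,
`ι a = a/‖a‖²`, is a smooth embedding with open range `{z ∈ F | z ≠ 0}` which tends to the point at
infinity: for every `z₀ ∈ F` over `0` and every neighbourhood `s` of `z₀`, `ι a ∈ s` once `‖a‖` is large.
[cite: Kosinski1993, Ch. VI §5] -/
theorem helper_friendsCarrier_inversion : ∀ (k : ℕ) (K₁ : (Metric.sphere (0 : EuclideanSpace ℝ (Fin 2)) 1) → EuclideanSpace ℝ (Fin 4)) (f₁ : EuclideanSpace ℝ (Fin 2) → EuclideanSpace ℝ (Fin 4)), Literature.Topology.FourManifolds.MMSW.IsModelSliceDisc k K₁ f₁ → ∀ (E F : TopologicalSpace.Opens (EuclideanSpace ℝ (Fin 4))), (E : Set (EuclideanSpace ℝ (Fin 4))) = {x | x ∉ Literature.Topology.FourManifolds.MMSW.modelHandlebody k ∧ x ∉ f₁ '' Metric.closedBall (0 : EuclideanSpace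 ℝ (Fin 2)) 1} → (F : Set (EuclideanSpace ℝ (Fin 4))) = {0} ∪ {y : EuclideanSpace ℝ (Fin 4) | y ≠ 0 ∧ (‖y‖ ^ 2)⁻¹ • y ∉ Literature.Topology.FourManifolds.MMSW.modelHandlebody k ∧ (‖y‖ ^ 2)⁻¹ • y ∉ f₁ '' Metric.closedBall (0 : EuclideanSpace ℝ (Fin 2)) 1} → (0 : EuclideanSpace ℝ (Fin 4)) ∈ F ∧ (∀ a : E, (a : EuclideanSpace ℝ (Fin 4)) ≠ 0) ∧ ∃ ι : E → F, (∀ a : E, ((ι a : F) : EuclideanSpace ℝ (Fin 4)) = (‖(a : EuclideanSpace ℝ (Fin 4))‖ ^ 2)⁻¹ • (a : EuclideanSpace ℝ (Fin 4))) ∧ Manifold.IsSmoothEmbedding (𝓡 4) (𝓡 4) ((⊤ : ℕ∞) : WithTop ℕ∞) ι ∧ IsOpen (Set.range ι) ∧ Set.range ι = {z : F | (z : EuclideanSpace ℝ (Fin 4)) ≠ 0} ∧ ∀ z₀ : F, (z₀ : EuclideanSpace ℝ (Fin 4)) = 0 → ∀ s ∈ nhds z₀, ∃ R : ℝ, ∀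 a : E, R < ‖(a : EuclideanSpace ℝ (Fin 4))‖ → ι a ∈ s := by
  intro k K₁ f₁ h E F hE hF
  -- the inversion
  set inv : EuclideanSpace ℝ (Fin 4) → EuclideanSpace ℝ (Fin 4) := fun y => (‖y‖ ^ 2)⁻¹ • y with hinv
  have hinvinv : ∀ {y : EuclideanSpace ℝ (Fin 4)}, y ≠ 0 → inv (inv y) = y := fun hy =>
    inv_normSq_smul_inv_normSq_smul hy
  have hinvne : ∀ {y : EuclideanSpace ℝ (Fin 4)}, y ≠ 0 → inv y ≠ 0 := fun hy => inv_normSq_smul_ne_zero hy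
  -- membership bookkeeping
  have hmemE : ∀ {x : EuclideanSpace ℝ (Fin 4)}, x ∈ (E : Set (EuclideanSpace ℝ (Fin 4))) ↔
      x ∉ modelHandlebody k ∧ x ∉ f₁ '' closedBall (0 : EuclideanSpace ℝ (Fin 2)) 1 := fun {x} => by
    rw [hE]; rfl
  have hmemF : ∀ {y : EuclideanSpace ℝ (Fin 4)}, y ∈ (F : Set (EuclideanSpace ℝ (Fin 4))) ↔
      y = 0 ∨ (y ≠ 0 ∧ inv y ∉ modelHandlebody k ∧ inv y ∉ f₁ '' closedBall (0 : EuclideanSpace ℝ (Fin 2)) 1) :=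
    fun {y} => by rw [hF]; simp [hinv]
  have h0F : (0 : EuclideanSpace ℝ (Fin 4)) ∈ F := hmemF.2 (Or.inl rfl)
  have hEne : ∀ a : E, (a : EuclideanSpace ℝ (Fin 4)) ≠ 0 := fun a ha =>
    (hmemE.1 a.2).1 (ha ▸ zero_mem_modelHandlebody k)
  have hιmem : ∀ a : E, inv (a : EuclideanSpace ℝ (Fin 4)) ∈ F := fun a =>
    hmemF.2 (Or.inr ⟨hinvne (hEne a), by rw [hinvinv (hEne a)]; exact (hmemE.1 a.2).1,
      by rw [hinvinv (hEne a)]; exact (hmemE.1 a.2).2⟩)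
  have hFmem : ∀ z : F, (z : EuclideanSpace ℝ (Fin 4)) ≠ 0 → inv (z : EuclideanSpace ℝ (Fin 4)) ∈ E :=
    fun z hz => by
      rcases hmemF.1 z.2 with h0 | ⟨-, h1, h2⟩
      · exact absurd h0 hz
      · exact hmemE.2 ⟨h1, h2⟩
  -- the map and a base point of `E` (needed for the junk value of the inverse)
  set ι : E → F := fun a => ⟨inv (a : EuclideanSpace ℝ (Fin 4)), hιmem a⟩ with hιdef
  refine ⟨h0F, hEne, ι, fun a => rfl, ?_⟩
  -- `E` is nonempty: a far point
  obtain ⟨C, hC⟩ := (isCompact_modelHandlebody_union_disc h).isBounded.exists_norm_le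
  set x₀ : EuclideanSpace ℝ (Fin 4) := EuclideanSpace.single 0 (|C| + 1) with hx₀
  have hx₀E : x₀ ∈ (E : Set (EuclideanSpace ℝ (Fin 4))) := by
    have hn : ‖x₀‖ = |C| + 1 := by
      rw [hx₀, PiLp.norm_single, Real.norm_eq_abs, abs_of_pos (by positivity)]
    have hnot : x₀ ∉ modelHandlebody k ∪ f₁ '' closedBall (0 : EuclideanSpace ℝ (Fin 2)) 1 := fun hm => by
      have := hC _ hm
      rw [hn] at this
      linarith [le_abs_self C]
    exact hmemE.2 (not_or.1 hnot)
  set a₀ : E := ⟨x₀, hx₀E⟩ with ha₀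
  -- the partial diffeomorphism `E ⇀ F`
  classical
  set Ψ : OpenPartialHomeomorph E F :=
    { toFun := ι
      invFun := fun z => if hz : (z : EuclideanSpace ℝ (Fin 4)) ≠ 0 then ⟨inv z, hFmem z hz⟩ else a₀
      source := univ
      target := {z : F | (z : EuclideanSpace ℝ (Fin 4)) ≠ 0}
      map_source' := fun a _ => hinvne (hEne a)
      map_target' := fun _ _ => mem_univ _
      left_inv' := fun a _ => by
        have hne : ((ι a : F) : EuclideanSpace ℝ (Fin 4)) ≠ 0 := hinvne (hEne a)
        rw [dif_pos hne]
        exact Subtype.ext (hinvinv (hEne a))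
      right_inv' := fun z hz => by
        rw [dif_pos (show (z : EuclideanSpace ℝ (Fin 4)) ≠ 0 from hz)]
        exact Subtype.ext (hinvinv hz)
      open_source := isOpen_univ
      open_target := isOpen_ne.preimage continuous_subtype_val
      continuousOn_toFun := by
        refine Continuous.continuousOn (Continuous.subtype_mk ?_ _)
        exact continuous_iff_continuousAt.2 fun a =>
          (contDiffAt_inv_normSq_smul (hEne a)).continuousAt.comp continuous_subtype_val.continuousAt
      continuousOn_invFun := by
        intro z hz
        refine ContinuousAt.continuousWithinAt ?_
        have hev : (Subtype.val ∘ fun z : F => if hz : (z : EuclideanSpace ℝ (Fin 4)) ≠ 0 then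
            (⟨inv z, hFmem z hz⟩ : E) else a₀) =ᶠ[𝓝 z] fun z => inv (z : EuclideanSpace ℝ (Fin 4)) := by
          filter_upwards [(isOpen_ne.preimage continuous_subtype_val).mem_nhds hz] with w hw
          simp only [comp_apply, dif_pos (show (w : EuclideanSpace ℝ (Fin 4)) ≠ 0 from hw)]
        have hcomp : ContinuousAt (fun w : F => inv (w : EuclideanSpace ℝ (Fin 4))) z :=
          (contDiffAt_inv_normSq_smul hz).continuousAt.comp continuous_subtype_val.continuousAt
        exact Topology.IsInducing.subtypeVal.continuousAt_iff.2 ((continuousAt_congr hev).2 hcomp) }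
    with hΨdef
  have hΨcoe : ⇑Ψ = ι := rfl
  have hΨs : ContMDiffOn (𝓡 4) (𝓡 4) ∞ Ψ Ψ.source := by
    intro a _
    refine ContMDiffAt.contMDiffWithinAt ?_
    rw [← ContMDiffAt.subtypeVal_comp_iff]
    exact ((contDiffAt_inv_normSq_smul (hEne a)).contMDiffAt).comp a contMDiff_subtype_val.contMDiffAt
  have hΨs' : ContMDiffOn (𝓡 4) (𝓡 4) ∞ Ψ.symm Ψ.target := by
    intro z hz
    have hz' : (z : EuclideanSpace ℝ (Fin 4)) ≠ 0 := hz
    refine ContMDiffAt.contMDiffWithinAt ?_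
    rw [← ContMDiffAt.subtypeVal_comp_iff]
    have hev : (Subtype.val ∘ Ψ.symm) =ᶠ[𝓝 z] fun z => inv (z : EuclideanSpace ℝ (Fin 4)) := by
      filter_upwards [(isOpen_ne.preimage continuous_subtype_val).mem_nhds hz'] with w hw
      have hw' : (w : EuclideanSpace ℝ (Fin 4)) ≠ 0 := hw
      show ((Ψ.symm w : E) : EuclideanSpace ℝ (Fin 4)) = inv w
      have : Ψ.symm w = ⟨inv w, hFmem w hw'⟩ := dif_pos hw'
      rw [this]
    refine ContMDiffAt.congr_of_eventuallyEq ?_ hev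
    exact ((contDiffAt_inv_normSq_smul hz').contMDiffAt).comp z contMDiff_subtype_val.contMDiffAt
  have hemb : Manifold.IsSmoothEmbedding (𝓡 4) (𝓡 4) ∞ Ψ :=
    isSmoothEmbedding_of_openPartialHomeomorph Ψ rfl hΨs hΨs'
      (ContinuousLinearEquiv.refl ℝ (EuclideanSpace ℝ (Fin 4)))
  have hrange : range ι = {z : F | (z : EuclideanSpace ℝ (Fin 4)) ≠ 0} := by
    rw [← hΨcoe, ← image_univ, ← show Ψ.source = univ from rfl, Ψ.image_source_eq_target]
  refine ⟨hΨcoe ▸ hemb, ?_, hrange, ?_⟩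
  · rw [hrange]
    exact isOpen_ne.preimage continuous_subtype_val
  · -- the limit at infinity
    intro z₀ hz₀ s hs
    obtain ⟨t, ht, hts⟩ := (mem_nhds_subtype _ _ _).1 hs
    rw [hz₀] at ht
    obtain ⟨r, hr, hrt⟩ := Metric.mem_nhds_iff.1 ht
    refine ⟨1 / r, fun a ha => hts ?_⟩
    rw [mem_preimage]
    apply hrt
    rw [mem_ball_zero_iff]
    show ‖inv (a : EuclideanSpace ℝ (Fin 4))‖ < r
    rw [hinv]
    dsimp only
    rw [norm_inv_normSq_smul]
    have hpos : 0 < 1 / r := by positivity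
    have ha' : 0 < ‖(a : EuclideanSpace ℝ (Fin 4))‖ := hpos.trans ha
    rw [inv_lt_comm₀ ha' hr]
    simpa [one_div] using ha

end Summit.SmoothPoincare4.SmoothPoincare4.Theorems.DcrGap.MkFriends

end
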